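import Literature.Geometry.Riemannian.MetricFlowFLimitPairAux3
import HarnessLib

/-!
# The limit of a fast `𝔽`-Cauchy chain within a correspondence, V: reproduction formula, conjugate
# heat flow property and `H`-concentration of the limit (Bamler 2023, §5.4, Lemma 5.20, Claim 5.22)

R. Bamler, *Compactness theory of the space of super Ricci flows*, Invent. Math. 233 (2023), §5.4,
proof of Lemma 5.20 (arXiv v1 Lemma 121), Claim 5.22 (arXiv v1 Claim 123): *"For Property (7) fix
`t₁, t₂, t₃ ∈ I ∖ E^∞`, `t₁ < t₂ < t₃`, `x^∞ ∈ X^∞_{t₃}`. It suffices to show that for every bounded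
Lipschitz function `f : X^∞_{t₃} → ℝ` [sic]
`∫_{X^∞_{t₁}} f dν^∞_{x^∞;t₁} = ∫_{X^∞_{t₂}} ∫_{X^∞_{t₁}} f dν^∞_{y;t₁} dν^∞_{x^∞;t₂}(y)`. … The
proof that `(μ^∞_t)_{t ∈ I ∖ E^∞}` is a conjugate heat flow on `𝒳^∞` is almost the same."*; and
§7.3, proof of the Lemma that `𝔽^J_I(H, V, b, r)` is closed (arXiv v1 Lemma 166), for the
`H`-concentration of a limit: *"It follows that `Var(ν^∞_{x^∞;s}, ν^∞_{y^∞;s}) ≤ limsup Var((φⁱ_s)_*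
νⁱ_{xⁱ;s}, (φⁱ_s)_* νⁱ_{yⁱ;s}) ≤ (d^∞_t(x^∞, y^∞))² + H(t − s)`"*.

Continuing `MetricFlowFLimitPairAux3.lean`, for the fast chain `S : ChainSetup I₀` this file proves:

* `ChainSetup.integral_νZ_eq_integral_integral` — the Lipschitz-integral form of the reproduction
  formula of the limit kernels, `∫ g dν^∞_{w;t₁} = ∫ (∫ g dν^∞_{y;t₁}) dν^∞_{w;t₂}(y)` for bounded
  Lipschitz `g : Z_{t₁} → ℝ` (the brick `integral_kernel_limit_eq_integral_integral` fed with the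
  reproduction formula of the approximants and Claim 5.21), and `ChainSetup.reproduction_limit` —
  Property (7) of Def. 3.2 for the limit, on sets (`comap_apply_eq_lintegral_kernel`);
* `ChainSetup.integral_m_eq_integral_integral`, `ChainSetup.supportMeasure_m_apply` — the same for
  `μ^∞_s = ∫ ν^∞_{x;s} dμ^∞_t(x)`: `(μ^∞_t)` is a conjugate heat flow on the limit;
* `ChainSetup.variance_kernel_le` — the limit is `H`-concentrated:
  `Var(ν^∞_{x₁;s}, ν^∞_{x₂;s}) ≤ d_t(x₁, x₂)² + H(t − s)` (lower semicontinuity of the variance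
  under `W₁`-convergence, `variance_le_liminf_of_tendsto_of_tendsto_wassersteinW1`, and the
  `H`-concentration of the approximants).

## References

* R. H. Bamler, *Compactness theory of the space of super Ricci flows*, Invent. Math. 233 (2023),
  1121–1277 (arXiv:2008.09298), §5.4, Lemma 5.20, Claims 5.21–5.22 (arXiv v1 Lemma 121,
  Claims 122–123); §3.4, Definition (`H`-concentration); §7.3 (arXiv v1 Lemma 166), proof.
[Bamler2023] -/

noncomputable section

open Set MeasureTheory Filter TopologicalSpace Function
open scoped Topology ENNReal NNReal

namespace Literature.Geometry.Riemannian

universe u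

/-- **Pushing forward by an isometric embedding does not increase the variance**:
`Var(φ_* μ, φ_* ν) ≤ Var(μ, ν)` (in fact equality; `∫ f d(φ_* μ) ≤ ∫ f ∘ φ dμ` twice and
`d(φ a, φ b) = d(a, b)`). [cite: Bamler2023, §2.2, Definition (Variance)] -/
theorem variance_map_le_of_isometry {X Y : Type*} [MetricSpace X] [MeasurableSpace X]
    [MetricSpace Y] [MeasurableSpace Y] {φ : X → Y} (hφ : Isometry φ) (μ ν : Measure X) :
    variance (μ.map φ) (ν.map φ) ≤ variance μ ν := by
  rw [variance_def, variance_def]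
  calc ∫⁻ a, ∫⁻ b, edist a b ^ 2 ∂(ν.map φ) ∂(μ.map φ)
      ≤ ∫⁻ a', ∫⁻ b, edist (φ a') b ^ 2 ∂(ν.map φ) ∂μ :=
        lintegral_map_le (fun a ↦ ∫⁻ b, edist a b ^ 2 ∂(ν.map φ)) φ
    _ ≤ ∫⁻ a', ∫⁻ b', edist (φ a') (φ b') ^ 2 ∂ν ∂μ :=
        lintegral_mono fun a' ↦ lintegral_map_le (fun b ↦ edist (φ a') b ^ 2) φ
    _ = ∫⁻ a', ∫⁻ b', edist a' b' ^ 2 ∂ν ∂μ := by simp_rw [hφ.edist_eq]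

namespace MetricFlowPair

open MetricFlow

namespace ChainSetup

variable {I₀ : Set ℝ} (S : ChainSetup.{u} I₀)

/-- Three times of the limit are good at a common stage.
[cite: Bamler2023, §5.4, Lemma 5.20 (arXiv v1 Lemma 121), proof] -/
theorem exists_mem_G₃ {t₁ t₂ t₃ : ℝ} (h₁ : t₁ ∈ S.I') (h₂ : t₂ ∈ S.I') (h₃ : t₃ ∈ S.I') :
    ∃ i, t₁ ∈ S.G i ∧ t₂ ∈ S.G i ∧ t₃ ∈ S.G i := by
  obtain ⟨a, ha₁, ha₂⟩ := S.exists_mem_G₂ h₁ h₂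
  obtain ⟨b, hb⟩ := S.exists_mem_G h₃
  exact ⟨a + b, S.G_mono (Nat.le_add_right a b) ha₁, S.G_mono (Nat.le_add_right a b) ha₂,
    S.G_mono (Nat.le_add_left b a) hb⟩

/-- The reproduction formula of the approximant `𝒳ⁿ` integrated against measurable `f ≥ 0`:
`∫ f dνⁿ_{x;t₁} = ∫ (∫ f dνⁿ_{y;t₁}) dνⁿ_{x;t₂}(y)` for `t₁ ≤ t₂ ≤ t₃`, `x ∈ 𝒳ⁿ_{t₃}`
(`condKernel_eq_comp`, `Measure.lintegral_bind`). [cite: Bamler2023, §3.1, Def. 3.2 (7)] -/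
theorem lintegral_condKernel_eq_lintegral_lintegral (n : ℕ) {t₁ t₂ t₃ : (S.P n).I'}
    (h12 : (t₁ : ℝ) ≤ t₂) (h23 : (t₂ : ℝ) ≤ t₃) (x : (S.P n).flow.Slice t₃)
    {f : (S.P n).flow.Slice t₁ → ℝ≥0∞} (hf : Measurable f) :
    ∫⁻ z, f z ∂((S.P n).flow.condKernel x t₁) =
      ∫⁻ y, ∫⁻ z, f z ∂((S.P n).flow.condKernel y t₁) ∂((S.P n).flow.condKernel x t₂) := by
  rw [(S.P n).flow.condKernel_eq_comp h12 h23 x,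
    Measure.lintegral_bind ((S.P n).flow.kernel h12).measurable.aemeasurable hf.aemeasurable]
  rfl

/-! ### The reproduction formula of the limit -/

/-- **Claim 5.22, Property (7) against bounded Lipschitz test functions**: for `t₁ ≤ t₂ ≤ t₃` in
`I'^{,∞}`, `w ∈ X^∞_{t₃}` and a bounded Lipschitz `g : Z_{t₁} → ℝ`,
`∫ g dν^∞_{w;t₁} = ∫ (∫ g dν^∞_{y;t₁}) dν^∞_{w;t₂}(y)` — the brick
`integral_kernel_limit_eq_integral_integral` at a common good stage, fed with the kernels of the
approximants based at an approximating sequence `φ_{t₃}(x_k) → w`, their reproduction formula, and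
Claim 5.21 (`tendsto_kpush_νZ`, `exists_seq_tendsto`, `support_νZ_subset`).
[cite: Bamler2023, §5.4, Lemma 5.20, Claim 5.22 (arXiv v1 Claim 123)] -/
theorem integral_νZ_eq_integral_integral {t₁ t₂ t₃ : ℝ} (h₁ : t₁ ∈ S.I') (h₂ : t₂ ∈ S.I')
    (h₃ : t₃ ∈ S.I') (h12 : t₁ ≤ t₂) (h23 : t₂ ≤ t₃) {w : S.ℭ.Z ⟨t₃, h₃.1⟩}
    (hw : w ∈ (S.m t₃ h₃).support) (g : S.ℭ.Z ⟨t₁, h₁.1⟩ → ℝ) {K : ℝ≥0} (hg : LipschitzWith K g)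
    {C : ℝ} (hgC : ∀ z, |g z| ≤ C) :
    ∫ z, g z ∂(S.νZ h₁ h₃ w) = ∫ y, (∫ z, g z ∂(S.νZ h₁ h₂ y)) ∂(S.νZ h₂ h₃ w) := by
  obtain ⟨i, hi₁, hi₂, hi₃⟩ := S.exists_mem_G₃ h₁ h₂ h₃
  obtain ⟨x, hx⟩ := S.exists_seq_tendsto h₃ hi₃ hw
  have h13 : t₁ ≤ t₃ := h12.trans h23
  haveI := S.isProbabilityMeasure_νZ h₁ h₃ h13 hw
  haveI := S.isProbabilityMeasure_νZ h₂ h₃ h23 hw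
  haveI := fun k (y : (S.P (i + k)).flow.Slice
      ⟨t₂, (S.ℭ.dom_subset (i + k) (S.memDom hi₂ k)).1⟩) ↦
    (S.P (i + k)).flow.isProbabilityMeasure_condKernel y
      (s := ⟨t₁, (S.ℭ.dom_subset (i + k) (S.memDom hi₁ k)).1⟩) h12
  haveI := fun k ↦ (S.P (i + k)).flow.isProbabilityMeasure_condKernel (x k)
    (s := ⟨t₁, (S.ℭ.dom_subset (i + k) (S.memDom hi₁ k)).1⟩) h13
  haveI := fun k ↦ (S.P (i + k)).flow.isProbabilityMeasure_condKernel (x k)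
    (s := ⟨t₂, (S.ℭ.dom_subset (i + k) (S.memDom hi₂ k)).1⟩) h23
  exact integral_kernel_limit_eq_integral_integral (Z₁ := S.ℭ.Z ⟨t₁, h₁.1⟩)
    (Z₂ := S.ℭ.Z ⟨t₂, h₂.1⟩)
    (fun k ↦ S.ℭ.φ (i + k) t₁ (S.memDom hi₁ k)) (fun k ↦ S.ℭ.φ (i + k) t₂ (S.memDom hi₂ k))
    (fun k ↦ S.ℭ.isometry (i + k) t₁ (S.memDom hi₁ k))
    (fun k ↦ S.ℭ.isometry (i + k) t₂ (S.memDom hi₂ k))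
    (fun k y ↦ (S.P (i + k)).flow.condKernel y ⟨t₁, (S.ℭ.dom_subset (i + k) (S.memDom hi₁ k)).1⟩)
    (fun k y y' ↦ (S.hP (i + k)).wassersteinW1_condKernel_le_edist h12 y y')
    (fun k ↦ (S.P (i + k)).flow.condKernel (x k) ⟨t₁, (S.ℭ.dom_subset (i + k) (S.memDom hi₁ k)).1⟩)
    (fun k ↦ (S.P (i + k)).flow.condKernel (x k) ⟨t₂, (S.ℭ.dom_subset (i + k) (S.memDom hi₂ k)).1⟩)
    (fun k f hf ↦ S.lintegral_condKernel_eq_lintegral_lintegral (i + k) h12 h23 (x k) hf)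
    (S.νZ h₁ h₃ w) (S.νZ h₂ h₃ w) (S.tendsto_kpush_νZ h₁ h₃ h13 hw hi₁ hi₃ x hx)
    (S.tendsto_kpush_νZ h₂ h₃ h23 hw hi₂ hi₃ x hx) (S.m t₂ h₂).support Measure.isClosed_support
    (S.νZ_compl_support h₂ h₃ h23 hw) (fun y hy ↦ S.exists_seq_tendsto h₂ hi₂ hy)
    (fun y ↦ S.νZ h₁ h₂ y) (fun y hy ↦ S.isProbabilityMeasure_νZ h₁ h₂ h12 hy)
    (fun y hy yn hyn ↦ S.tendsto_kpush_νZ h₁ h₂ h12 hy hi₁ hi₂ yn hyn) g hg hgC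

/-- **Claim 5.22, Property (7) of Def. 3.2 for the limit flow**: for `t₁ ≤ t₂ ≤ t₃` in `I'^{,∞}`,
`x ∈ X^∞_{t₃}` and measurable `A ⊆ X^∞_{t₁}`,
`ν^∞_{x;t₁}(A) = ∫_{X^∞_{t₂}} ν^∞_{y;t₁}(A) dν^∞_{x;t₂}(y)` (from the Lipschitz-integral identity,
`comap_apply_eq_lintegral_kernel`).
[cite: Bamler2023, §5.4, Lemma 5.20, Claim 5.22 (arXiv v1 Claim 123)] -/
theorem reproduction_limit {t₁ t₂ t₃ : ℝ} (h₁ : t₁ ∈ S.I') (h₂ : t₂ ∈ S.I') (h₃ : t₃ ∈ S.I')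
    (h12 : t₁ ≤ t₂) (h23 : t₂ ≤ t₃) (x : S.X t₃ h₃) (A : Set (S.X t₁ h₁))
    (hA : MeasurableSet A) :
    S.kernel h₃ x h₁ A = ∫⁻ y, S.kernel h₂ y h₁ A ∂(S.kernel h₃ x h₂) := by
  haveI := S.isProbabilityMeasure_νZ h₂ h₃ h23 x.2
  haveI := S.isProbabilityMeasure_νZ h₁ h₃ (h12.trans h23) x.2
  exact S.comap_apply_eq_lintegral_kernel h₁ h₂ h12 (S.νZ h₂ h₃ x.1)
    (S.νZ_compl_support h₂ h₃ h23 x.2) (S.νZ h₁ h₃ x.1)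
    (S.νZ_compl_support h₁ h₃ (h12.trans h23) x.2)
    (fun g K hg hg01 ↦ S.integral_νZ_eq_integral_integral h₁ h₂ h₃ h12 h23 x.2 g hg
      (abs_le_one_of_mem_Icc hg01)) A hA

/-! ### `(μ^∞_t)` is a conjugate heat flow on the limit -/

/-- **`∫ g dμ^∞_s = ∫ (∫ g dν^∞_{y;s}) dμ^∞_t(y)`** for `s ≤ t` in `I'^{,∞}` and bounded Lipschitz
`g : Z_s → ℝ` (*"The proof that `(μ^∞_t)` is a conjugate heat flow on `𝒳^∞` is almost the same"*:
the brick `integral_kernel_limit_eq_integral_integral` read with `μⁿ_s`, `μⁿ_t` in place of the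
kernels based at `xⁿ`, fed with the conjugate heat flow identity of `P n`).
[cite: Bamler2023, §5.4, Lemma 5.20, Claim 5.22 (arXiv v1 Claim 123)] -/
theorem integral_m_eq_integral_integral {s t : ℝ} (hs : s ∈ S.I') (ht : t ∈ S.I') (hst : s ≤ t)
    (g : S.ℭ.Z ⟨s, hs.1⟩ → ℝ) {K : ℝ≥0} (hg : LipschitzWith K g) {C : ℝ} (hgC : ∀ z, |g z| ≤ C) :
    ∫ z, g z ∂(S.m s hs) = ∫ y, (∫ z, g z ∂(S.νZ hs ht y)) ∂(S.m t ht) := by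
  obtain ⟨i, hsi, hti⟩ := S.exists_mem_G₂ hs ht
  haveI := fun k (y : (S.P (i + k)).flow.Slice
      ⟨t, (S.ℭ.dom_subset (i + k) (S.memDom hti k)).1⟩) ↦
    (S.P (i + k)).flow.isProbabilityMeasure_condKernel y
      (s := ⟨s, (S.ℭ.dom_subset (i + k) (S.memDom hsi k)).1⟩) hst
  haveI := fun k ↦ (S.P (i + k)).isProbabilityMeasure_μ
    ⟨t, (S.ℭ.dom_subset (i + k) (S.memDom hti k)).1⟩
  haveI := fun k ↦ (S.P (i + k)).isProbabilityMeasure_μ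
    ⟨s, (S.ℭ.dom_subset (i + k) (S.memDom hsi k)).1⟩
  exact integral_kernel_limit_eq_integral_integral (Z₁ := S.ℭ.Z ⟨s, hs.1⟩)
    (Z₂ := S.ℭ.Z ⟨t, ht.1⟩)
    (fun k ↦ S.ℭ.φ (i + k) s (S.memDom hsi k)) (fun k ↦ S.ℭ.φ (i + k) t (S.memDom hti k))
    (fun k ↦ S.ℭ.isometry (i + k) s (S.memDom hsi k))
    (fun k ↦ S.ℭ.isometry (i + k) t (S.memDom hti k))
    (fun k y ↦ (S.P (i + k)).flow.condKernel y ⟨s, (S.ℭ.dom_subset (i + k) (S.memDom hsi k)).1⟩)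
    (fun k y y' ↦ (S.hP (i + k)).wassersteinW1_condKernel_le_edist hst y y')
    (fun k ↦ (S.P (i + k)).μ ⟨s, (S.ℭ.dom_subset (i + k) (S.memDom hsi k)).1⟩)
    (fun k ↦ (S.P (i + k)).μ ⟨t, (S.ℭ.dom_subset (i + k) (S.memDom hti k)).1⟩)
    (fun k f hf ↦ S.lintegral_μ_eq_lintegral_lintegral (i + k) hst hf)
    (S.m s hs) (S.m t ht) (S.tendsto_push_m hs hsi) (S.tendsto_push_m ht hti)
    (S.m t ht).support Measure.isClosed_support Measure.measure_compl_support
    (fun y hy ↦ S.exists_seq_tendsto ht hti hy)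
    (fun y ↦ S.νZ hs ht y) (fun y hy ↦ S.isProbabilityMeasure_νZ hs ht hst hy)
    (fun y hy yn hyn ↦ S.tendsto_kpush_νZ hs ht hst hy hsi hti yn hyn) g hg hgC

/-- **`(μ^∞_t)_{t ∈ I'^{,∞}}` is a conjugate heat flow on the limit**:
`μ^∞_s(A) = ∫_{X^∞_t} ν^∞_{x;s}(A) dμ^∞_t(x)` for `s ≤ t` in `I'^{,∞}` and measurable `A ⊆ X^∞_s`,
the measures being restricted to the limit slices (`supportMeasure`).
[cite: Bamler2023, §5.4, Lemma 5.20, Claim 5.22 (arXiv v1 Claim 123)] -/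
theorem supportMeasure_m_apply {s t : ℝ} (hs : s ∈ S.I') (ht : t ∈ S.I') (hst : s ≤ t)
    (A : Set (S.X s hs)) (hA : MeasurableSet A) :
    supportMeasure (S.m s hs) A = ∫⁻ x, S.kernel ht x hs A ∂(supportMeasure (S.m t ht)) :=
  S.comap_apply_eq_lintegral_kernel hs ht hst (S.m t ht) Measure.measure_compl_support (S.m s hs)
    Measure.measure_compl_support (fun g _ hg hg01 ↦
      S.integral_m_eq_integral_integral hs ht hst g hg (abs_le_one_of_mem_Icc hg01)) A hA

/-! ### `H`-concentration of the limit -/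

/-- **The limit flow is `H`-concentrated**: for `s ≤ t` in `I'^{,∞}` and `x₁, x₂ ∈ X^∞_t`,
`Var(ν^∞_{x₁;s}, ν^∞_{x₂;s}) ≤ d_t(x₁, x₂)² + H(t − s)`. With approximating sequences
`φ_t(y¹_k) → x₁`, `φ_t(y²_k) → x₂` (Claim 5.21): `Var(ν^∞_{x₁;s}, ν^∞_{x₂;s}) ≤
liminf Var((φ_s)_* ν_{y¹_k;s}, (φ_s)_* ν_{y²_k;s}) ≤ liminf (d_t(y¹_k, y²_k)² + H(t − s))
= d_t(x₁, x₂)² + H(t − s)` (lower semicontinuity of `Var` under `W₁`-convergence, the variance does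
not increase under `φ_s`, `H`-concentration of the approximants).
[cite: Bamler2023, §3.4, Definition (H-concentration); §7.3 (arXiv v1 Lemma 166), proof] -/
theorem variance_kernel_le {s t : ℝ} (hs : s ∈ S.I') (ht : t ∈ S.I') (hst : s ≤ t)
    (x₁ x₂ : S.X t ht) :
    variance (S.kernel ht x₁ hs) (S.kernel ht x₂ hs) ≤
      edist x₁ x₂ ^ 2 + ENNReal.ofReal (S.H * (t - s)) := by
  rw [S.variance_kernel_eq hs ht hst]
  obtain ⟨i, hsi, hti⟩ := S.exists_mem_G₂ hs ht
  obtain ⟨y₁, hy₁⟩ := S.exists_seq_tendsto ht hti x₁.2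
  obtain ⟨y₂, hy₂⟩ := S.exists_seq_tendsto ht hti x₂.2
  haveI := S.isProbabilityMeasure_νZ hs ht hst x₁.2
  haveI := S.isProbabilityMeasure_νZ hs ht hst x₂.2
  haveI := fun k ↦ S.isProbabilityMeasure_kpush (i + k) hs.1 (S.memDom hsi k) (S.memDom hti k) hst
    (y₁ k)
  haveI := fun k ↦ S.isProbabilityMeasure_kpush (i + k) hs.1 (S.memDom hsi k) (S.memDom hti k) hst
    (y₂ k)
  have hlsc := variance_le_liminf_of_tendsto_of_tendsto_wassersteinW1
    (S.tendsto_kpush_νZ hs ht hst x₁.2 hsi hti y₁ hy₁)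
    (S.tendsto_kpush_νZ hs ht hst x₂.2 hsi hti y₂ hy₂)
  refine hlsc.trans ?_
  -- per `k`: the variance of the pushed kernels is bounded by the `H`-concentration of `P (i + k)`
  have hk : ∀ k, variance (S.kpush (i + k) hs.1 (S.memDom hsi k) (S.memDom hti k) (y₁ k))
      (S.kpush (i + k) hs.1 (S.memDom hsi k) (S.memDom hti k) (y₂ k)) ≤
        edist (S.ℭ.φ (i + k) t (S.memDom hti k) (y₁ k) : S.ℭ.Z ⟨t, ht.1⟩)
          (S.ℭ.φ (i + k) t (S.memDom hti k) (y₂ k)) ^ 2 + ENNReal.ofReal (S.H * (t - s)) := by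
    intro k
    rw [(S.ℭ.isometry (i + k) t (S.memDom hti k)).edist_eq]
    exact (variance_map_le_of_isometry (S.ℭ.isometry (i + k) s (S.memDom hsi k)) _ _).trans
      ((S.hP (i + k)).variance_le hst (y₁ k) (y₂ k))
  -- the right-hand sides converge
  have hlim : Tendsto (fun k ↦ edist (S.ℭ.φ (i + k) t (S.memDom hti k) (y₁ k) : S.ℭ.Z ⟨t, ht.1⟩)
      (S.ℭ.φ (i + k) t (S.memDom hti k) (y₂ k)) ^ 2 + ENNReal.ofReal (S.H * (t - s))) atTop
      (𝓝 (edist x₁.1 x₂.1 ^ 2 + ENNReal.ofReal (S.H * (t - s)))) :=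
    (ENNReal.Tendsto.pow (hy₁.edist hy₂)).add tendsto_const_nhds
  calc liminf (fun k ↦ variance (S.kpush (i + k) hs.1 (S.memDom hsi k) (S.memDom hti k) (y₁ k))
        (S.kpush (i + k) hs.1 (S.memDom hsi k) (S.memDom hti k) (y₂ k))) atTop
      ≤ liminf (fun k ↦ edist (S.ℭ.φ (i + k) t (S.memDom hti k) (y₁ k) : S.ℭ.Z ⟨t, ht.1⟩)
          (S.ℭ.φ (i + k) t (S.memDom hti k) (y₂ k)) ^ 2 + ENNReal.ofReal (S.H * (t - s))) atTop :=
        liminf_le_liminf (Eventually.of_forall hk)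
    _ = edist x₁.1 x₂.1 ^ 2 + ENNReal.ofReal (S.H * (t - s)) := hlim.liminf_eq

end ChainSetup

end MetricFlowPair

end Literature.Geometry.Riemannian

end
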